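import Literature.Geometry.Lorentzian.EventHorizon
import Literature.Geometry.Lorentzian.CutBondiMass
import Literature.Geometry.Lorentzian.ConvergenceTransport
import Literature.Geometry.Lorentzian.CauchyDevelopmentIsometryClasses
import HarnessLib

/-!
# Named fact: the cut-Bondi-mass ledger and the horizon-section area ledger of a vacuum Cauchy
# development are invariants of its isometry class (`LedgerIsoInvariant`)

Layer `Literature/Geometry/Lorentzian` (family `gr`, summit `FinalStateConjecture`). Port of the
porting brick **I — `LedgerIsoInvariant`** of the decomposition cell `decomp-fsc` (lens-5 g8 kernel
`FarDoorClosing.lean`, registrar row D22), requested by work item `wi-97683` («port: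
LedgerIsoInvariant», for `stmt-FinalStateConjecture-29290` `RootDecompFarLedgerCells.FarAccountDoor`,
`stmt-FinalStateConjecture-29968` `RootDecompSobolevLedgerCells.SobolevAccountDoor` and lens-4's
`SettlingIso`): the statement is ported VERBATIM from the kernel (same binders, same `let`s, same
body; kernel text `LedgerIsoInvariant.oneline.txt`, sha16 `d114b4260e6e9cda`) over the tree carriers
`VacuumCauchyDevelopment`, `CauchyDevelopment.IsIsometricTo` (`CauchyDevelopment.lean`),
`CauchyDevelopment.HasCutBondiMass` (`CutBondiMass.lean`), `DataEmbedding.futureEventHorizon`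
(`EventHorizon.lean`), `area` (`Volume.lean`), `pullbackBilin`, `NormalField`,
`LorentzianMetric.IsFutureUnitNormal`, `PseudoRiemannianMetric.secondFundamentalForm`,
`LorentzianMetric.IsCauchyHypersurface`, `LorentzianMetric.causalFuture`, and is consumed at exactly
this shape by the kernel's certificates `chargeCoherence_of_leaves`, `farAccountDoor_of_leaves''`,
`sobolevAccountDoor_of_leaves` (`FarAccountDoor ⟸ F1 ∧ F2 ∧ F3′ ∧ F4 ∧ U ∧ I`).

## The statement

For a connected `3`-manifold `X`, an initial data set `d` on `X` and two VACUUM CAUCHY DEVELOPMENTS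
`𝒟₁`, `𝒟₂` of `d` which are ISOMETRIC AS DEVELOPMENTS (`CauchyDevelopment.IsIsometricTo`: a smooth
diffeomorphism `ψ : M₁ ≃ M₂` with `ψ^* g₂ = g₁`, preserving the time orientations, `ψ ∘ ι₁ = ι₂`),
the two "ledger entries" of the cell agree:

* `MassF d 𝒟 = ⨅ (K compact ⊆ M) (m : ℝ) (_ : HasCutBondiMass 𝒟 K m), ofReal m` — the infimum of the
  Bondi masses of the cuts `𝓘⁺ ∩ ∂J⁺(K)` of `𝒟` (`VacuumCauchyDevelopment.massLedger` below);
* `AreaF d 𝒟 = sInf {a | every embedded future Cauchy slice (X′, D′, ι′, ν′) of 𝒟 has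
  area_{D′.h}(ι′ ⁻¹(𝓗⁺(𝒟))) ≤ a}` — the least upper bound of the areas of the sections of the future
  event horizon by embedded Cauchy slices to the future of the data
  (`VacuumCauchyDevelopment.horizonAreaLedger` below);

namely `MassF d 𝒟₁ = MassF d 𝒟₂ ∧ AreaF d 𝒟₁ = AreaF d 𝒟₂`. No maximality, no admissibility, no
field equation beyond what the carriers carry.

## Why it holds (structural naturality — the proof route, for the discharge)

Every ingredient of `MassF` and `AreaF` is built from `(g, τ, ι, ν)` by operations that are natural
under a time-orientation preserving isometric diffeomorphism `ψ` commuting with the data embeddings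
(O'Neill 1983, Ch. 3, Prop. 3.59–3.62: isometries preserve the Levi-Civita connection, geodesics and
curvature; Ch. 14, pp. 402–403: time-orientation preserving isometries preserve the causal
relations):

1. *Cut Bondi masses transport*, `HasCutBondiMass 𝒟₁ K m ↔ HasCutBondiMass 𝒟₂ (ψ '' K) m`: a round
   receding family `s ↦ S_s` on `∂J⁺₁(K)` (`CauchyDevelopment.RoundSectionFamily`) goes to
   `s ↦ ψ ∘ S_s` on `ψ(∂J⁺₁(K)) = ∂J⁺₂(ψ K)` (`image_causalFuture_eq_of_inverse` below, PROVED from the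
   tree's `LorentzianMetric.image_causalFuture_subset`, and `Homeomorph.image_frontier`), with null
   normal pair `(dψ L, dψ L̲)`, the same induced metrics (`pullbackBilin_comp`: `(ψ ∘ S)^* g₂ = S^* g₁`),
   hence the same areas and Gauss curvatures, tangent to the generators because `ψ` maps
   `g₁`-geodesics to `g₂`-geodesics (`Literature.Geometry.Riemannian.SimpleAH.isGeodesicOn_comp`), and
   the same Hawking masses (null expansions are natural: `HypersurfaceNaturality`,
   `mfderiv_covariantDerivAlong_comap`); compact `K ↦ ψ '' K` is a bijection on compact sets — whence
   `MassF d 𝒟₁ = MassF d 𝒟₂` (`massLedger_eq_of_hasCutBondiMass_transport` below, PROVED: the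
   reduction of the mass clause to the transport of `HasCutBondiMass`).
2. *Admissible horizon slices transport*, `(X′, D′, ι′, ν′) ↦ (X′, D′, ψ ∘ ι′, dψ ∘ ν′)`: smooth
   embeddings compose with diffeomorphisms; `dψ` is a linear isometry on tangent spaces preserving
   the time cones, so future unit normals go to future unit normals; `(ψ ∘ ι′)^* g₂ = ι′^* g₁`
   (`pullbackBilin_comp`); second fundamental forms are natural (`secondFundamentalForm_comap`,
   `HypersurfaceNaturality.lean`); Cauchy hypersurfaces correspond
   (`IsCauchyHypersurface.preimage_of_isIsometricImmersion`, `CauchyHypersurfaceTransfer.lean`);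
   `ψ(J⁺₁(range ι₁)) = J⁺₂(range ι₂)` as in 1.; and `ψ(𝓗⁺(𝒟₁)) = 𝓗⁺(𝒟₂)` because `𝓗⁺ = ∂ I⁻(rays)`
   (`EventHorizon.lean`) and normalised future-complete null rays from the data correspond under `ψ`
   (maximal geodesics lift along equidimensional local isometries, O'Neill 1983, Ch. 3, Prop. 3.24;
   `dψ (ν₁ p) = ν₂ p` by uniqueness of the future unit normal of the spacelike hypersurface
   `ι₂(X) = ψ(ι₁(X))`), so `ι′ ⁻¹(𝓗⁺(𝒟₁)) = (ψ ∘ ι′) ⁻¹(𝓗⁺(𝒟₂))` and the two sets of bounds `a`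
   coincide — whence `AreaF d 𝒟₁ = AreaF d 𝒟₂`.

The sibling statement for Christodoulou's completeness of `𝓘⁺` over the (uninhabited) structure
`Development` is the tree's named fact `Development.hasCompleteFutureNullInfinity_iff_of_isIsometricTo`
(`NullInfinity.lean`); for `CauchyDevelopment`s the corresponding transport of normalised null rays is
carried out in `Summits/FinalStateConjecture/…/Theorems/PhaseMixingCaptureWeakCosmicCensorshipMGHD*`
(not importable from `Literature/`). The present file records the ledger invariance as ONE named fact
(net debt +1, the cite item) together with the PROVED reductions `ledgerIsoInvariant_iff`,
`massLedger_eq_of_hasCutBondiMass_transport`, `image_causalFuture_eq_of_inverse`,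
`CauchyDevelopment.image_causalFuture_eq`, `CauchyDevelopment.image_frontier_causalFuture_eq`; the
discharge `theorem ledgerIsoInvariant_holds : LedgerIsoInvariant` is the remaining (PDE-free, L-sized)
porting task along steps 1–2.

## References

* B. O'Neill, *Semi-Riemannian Geometry with Applications to Relativity*, Academic Press 1983,
  Ch. 3, Prop. 3.59–3.62, pp. 90–92 (isometries preserve the Levi-Civita connection, geodesics,
  curvature), Prop. 3.24 (maximal geodesics), Ch. 14, pp. 402–403 (causality under isometries).
* H. Ringström, *The Cauchy Problem in General Relativity*, EMS 2009, Thm. 16.6 (the MGHD is unique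
  up to an isometry commuting with the data embeddings — the isometries quantified here).
* Y. Choquet-Bruhat, R. Geroch, *Global aspects of the Cauchy problem in general relativity*,
  Comm. Math. Phys. 14 (1969) 329–335, Theorem 3.
* D. Christodoulou, S. Klainerman, *The global nonlinear stability of the Minkowski space*, Princeton
  1993, Ch. 17 (Hawking mass, Bondi mass of a cut) — the quantities of `CutBondiMass.lean`.
* R. M. Wald, *General Relativity*, Chicago 1984, §12.1–12.2 (event horizon, horizon area).
-/

noncomputable section

open Set Function Filter Topology
open scoped Manifold ContDiff ENNReal

namespace Literature.Geometry.Lorentzian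

universe u

/-! ### Causal futures under a pair of mutually inverse time-orientation preserving isometric maps -/

section Generic

variable {E : Type*} [NormedAddCommGroup E] [NormedSpace ℝ E] {H : Type*} [TopologicalSpace H]
  {I : ModelWithCorners ℝ E H} {n : ℕ∞ω} {M : Type*} [TopologicalSpace M] [ChartedSpace H M]
  [IsManifold I ∞ M]
  {E' : Type*} [NormedAddCommGroup E'] [NormedSpace ℝ E'] {H' : Type*} [TopologicalSpace H']
  {I' : ModelWithCorners ℝ E' H'} {N : Type*} [TopologicalSpace N] [ChartedSpace H' N]
  [IsManifold I' ∞ N]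

namespace LorentzianMetric

variable {g : LorentzianMetric I n M} {τ : TimeOrientation g}
  {gN : LorentzianMetric I' n N} {τN : TimeOrientation gN}

/-- **`φ(J⁺(S)) = J⁺(φ(S))` for a time-orientation preserving isometric map `φ : N → M` with a
time-orientation preserving isometric inverse `χ : M → N`** (both differentiable): `⊆` is the tree's
`image_causalFuture_subset` for `φ`; `⊇` is `image_causalFuture_subset` for `χ` applied to `φ(S)`,
transported back by `φ ∘ χ = id`. O'Neill 1983, Ch. 14, pp. 402–403; Hawking–Ellis 1973, §6.2.
[cite: ONeillSemiRiemannian1983, Ch. 14, pp. 402–403] -/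
theorem image_causalFuture_eq_of_inverse {φ : N → M} {χ : M → N}
    (hφd : MDifferentiable I' I φ) (hχd : MDifferentiable I I' χ)
    (hτφ : τN.PreservesTimeOrientation φ τ) (hτχ : τ.PreservesTimeOrientation χ τN)
    (hφ : ∀ y, pullbackBilin (I := I) (I' := I') φ g.val y = gN.val y)
    (hχ : ∀ x, pullbackBilin (I := I') (I' := I) χ gN.val x = g.val x)
    (hχφ : ∀ y, χ (φ y) = y) (hφχ : ∀ x, φ (χ x) = x) (S : Set N) :
    φ '' gN.causalFuture τN S = g.causalFuture τ (φ '' S) := by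
  refine (image_causalFuture_subset hφd hτφ hφ S).antisymm ?_
  intro x hx
  have hx' : χ x ∈ gN.causalFuture τN (χ '' (φ '' S)) :=
    image_causalFuture_subset hχd hτχ hχ (φ '' S) (mem_image_of_mem χ hx)
  have hS : χ '' (φ '' S) = S := by
    rw [← image_comp, show χ ∘ φ = id from funext hχφ, image_id]
  rw [hS] at hx'
  exact ⟨χ x, hx', hφχ x⟩

/-- The same for the **achronal boundaries**: `φ(∂J⁺(S)) = ∂J⁺(φ(S))` when `φ` is moreover a
homeomorphism with inverse `χ` (frontiers are natural under homeomorphisms,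
`Homeomorph.image_frontier`). O'Neill 1983, Ch. 14, pp. 402–403. [cite: ONeillSemiRiemannian1983, Ch. 14, pp. 402–403] -/
theorem image_frontier_causalFuture_eq_of_inverse (φ : N ≃ₜ M)
    (hφd : MDifferentiable I' I φ) (hχd : MDifferentiable I I' φ.symm)
    (hτφ : τN.PreservesTimeOrientation φ τ) (hτχ : τ.PreservesTimeOrientation φ.symm τN)
    (hφ : ∀ y, pullbackBilin (I := I) (I' := I') φ g.val y = gN.val y)
    (hχ : ∀ x, pullbackBilin (I := I') (I' := I) φ.symm gN.val x = g.val x) (S : Set N) :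
    φ '' frontier (gN.causalFuture τN S) = frontier (g.causalFuture τ (φ '' S)) := by
  rw [φ.image_frontier, image_causalFuture_eq_of_inverse hφd hχd hτφ hτχ hφ hχ
    φ.symm_apply_apply φ.apply_symm_apply S]

end LorentzianMetric

end Generic

/-! ### Specialisation to isometric Cauchy developments -/

section Developments

variable {X : Type u} [TopologicalSpace X] [ChartedSpace E3 X] [IsManifold (𝓡 3) ∞ X]
  [ConnectedSpace X] {D : InitialDataSet (𝓡 3) X}

namespace CauchyDevelopment

/-- **Along an isometry of Cauchy developments the causal futures correspond**: if
`ψ : M₁ ≃ M₂` is a smooth diffeomorphism with `ψ^* g₂ = g₁` preserving the time orientations, then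
`ψ(J⁺₁(K)) = J⁺₂(ψ K)` for every `K ⊆ M₁`. The inverse `ψ⁻¹` is again an isometry
(`(ψ⁻¹)^* g₁ = (ψ⁻¹)^* ψ^* g₂ = g₂`, chain rule `pullbackBilin_comp`) and preserves the time
orientations (converse timecone lemma `PreservesTimeOrientation.isFutureDirected_of_mfderiv` applied
to `dψ (dψ⁻¹ T₂) = T₂`), so `image_causalFuture_eq_of_inverse` applies. O'Neill 1983, Ch. 3, p. 90–91
and Ch. 14, pp. 402–403. [cite: ONeillSemiRiemannian1983, Ch. 14, pp. 402–403] -/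
theorem image_causalFuture_eq (𝒟₁ 𝒟₂ : CauchyDevelopment D)
    (ψ : Diffeomorph (𝓡 (3 + 1)) (𝓡 (3 + 1)) 𝒟₁.carrier 𝒟₂.carrier ∞)
    (hiso : 𝒟₁.metric.IsIsometry 𝒟₂.metric.toPseudoRiemannianMetric ψ)
    (hτ : 𝒟₁.timeOrientation.PreservesTimeOrientation ψ 𝒟₂.timeOrientation)
    (K : Set 𝒟₁.carrier) :
    ψ '' 𝒟₁.metric.causalFuture 𝒟₁.timeOrientation K =
      𝒟₂.metric.causalFuture 𝒟₂.timeOrientation (ψ '' K) := by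
  have hψd : MDifferentiable (𝓡 (3 + 1)) (𝓡 (3 + 1)) ψ := ψ.contMDiff.mdifferentiable (by simp)
  have hψsd : MDifferentiable (𝓡 (3 + 1)) (𝓡 (3 + 1)) ψ.symm :=
    ψ.symm.contMDiff.mdifferentiable (by simp)
  have hid : (ψ : 𝒟₁.carrier → 𝒟₂.carrier) ∘ ψ.symm = id := funext ψ.apply_symm_apply
  -- the inverse diffeomorphism is an isometry
  have hiso' : ∀ z, pullbackBilin (I := 𝓡 (3 + 1)) (I' := 𝓡 (3 + 1)) ψ.symm 𝒟₁.metric.val z =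
      𝒟₂.metric.val z := by
    intro z
    have h1 : 𝒟₁.metric.val =
        pullbackBilin (I := 𝓡 (3 + 1)) (I' := 𝓡 (3 + 1)) ψ 𝒟₂.metric.val :=
      (funext hiso).symm
    rw [h1, ← pullbackBilin_comp hψd hψsd, hid, pullbackBilin_id]
  -- `dψ ∘ dψ⁻¹ = id`
  have hkey : ∀ (z : 𝒟₂.carrier) (w : TangentSpace (𝓡 (3 + 1)) z),
      mfderiv (𝓡 (3 + 1)) (𝓡 (3 + 1)) ψ (ψ.symm z)
        (mfderiv (𝓡 (3 + 1)) (𝓡 (3 + 1)) ψ.symm z w) = w := by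
    intro z w
    have h := mfderiv_comp z (hψd (ψ.symm z)) (hψsd z)
    rw [hid, mfderiv_id] at h
    exact (congrArg (fun L ↦ L w) h).symm
  -- the inverse preserves the time orientations
  have hτ' : 𝒟₂.timeOrientation.PreservesTimeOrientation ψ.symm 𝒟₁.timeOrientation := by
    intro z
    refine hτ.isFutureDirected_of_mfderiv hiso ?_
    rw [hkey, ψ.apply_symm_apply]
    exact 𝒟₂.timeOrientation.isFutureDirected_vectorField z
  exact LorentzianMetric.image_causalFuture_eq_of_inverse hψd hψsd hτ hτ' hiso hiso'
    ψ.symm_apply_apply ψ.apply_symm_apply K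

/-- **The null cones `∂J⁺(K)` correspond along an isometry of Cauchy developments**:
`ψ(∂J⁺₁(K)) = ∂J⁺₂(ψ K)` — the set on which the round receding families of `HasCutBondiMass 𝒟 K`
live (`CutBondiMass.lean`). O'Neill 1983, Ch. 14, pp. 402–403. [cite: ONeillSemiRiemannian1983, Ch. 14, pp. 402–403] -/
theorem image_frontier_causalFuture_eq (𝒟₁ 𝒟₂ : CauchyDevelopment D)
    (ψ : Diffeomorph (𝓡 (3 + 1)) (𝓡 (3 + 1)) 𝒟₁.carrier 𝒟₂.carrier ∞)
    (hiso : 𝒟₁.metric.IsIsometry 𝒟₂.metric.toPseudoRiemannianMetric ψ)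
    (hτ : 𝒟₁.timeOrientation.PreservesTimeOrientation ψ 𝒟₂.timeOrientation)
    (K : Set 𝒟₁.carrier) :
    ψ '' frontier (𝒟₁.metric.causalFuture 𝒟₁.timeOrientation K) =
      frontier (𝒟₂.metric.causalFuture 𝒟₂.timeOrientation (ψ '' K)) := by
  rw [← image_causalFuture_eq 𝒟₁ 𝒟₂ ψ hiso hτ K]
  exact ψ.toHomeomorph.image_frontier _

end CauchyDevelopment

/-! ### The two ledger entries -/

namespace VacuumCauchyDevelopment

/-- The **cut-Bondi-mass ledger entry** `MassF d 𝒟` of the cell `decomp-fsc` (VERBATIM its `let`):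
`⨅` over the compact sets `K ⊆ M` and the reals `m` with `HasCutBondiMass 𝒟 K m` (the cut
`𝓘⁺ ∩ ∂J⁺(K)` has Bondi mass `m` as measured by some asymptotically round receding family,
`CutBondiMass.lean`) of `ENNReal.ofReal m` — the infimum of the Bondi masses of all cuts of `𝓘⁺`, in
`ℝ≥0∞` (`⊤` if no cut has a Bondi mass). Christodoulou–Klainerman 1993, Ch. 17, Conclusion 17.0.4
(the Bondi mass `M(u)` of the cut `C_u`, nonincreasing towards the future; its infimum over cuts is
the final Bondi mass). [cite: ChristodoulouKlainerman1993PMS41, Ch. 17, Conclusion 17.0.4] -/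
def massLedger (𝒟 : VacuumCauchyDevelopment D) : ℝ≥0∞ :=
  ⨅ (K : Set 𝒟.carrier) (_ : IsCompact K) (m : ℝ) (_ : 𝒟.toCauchyDevelopment.HasCutBondiMass K m),
    ENNReal.ofReal m

/-- The **horizon-section area ledger entry** `AreaF d 𝒟` of the cell `decomp-fsc` (VERBATIM its
`let`): the `sInf` of all `a : ℝ≥0∞` bounding the areas `area_{D′.h}(ι′ ⁻¹(𝓗⁺(𝒟)))` of the sections
of the future event horizon `𝓗⁺(𝒟)` (`DataEmbedding.futureEventHorizon`, `EventHorizon.lean`) by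
every embedded Cauchy slice `(X′, D′, ι′, ν′)` of `𝒟` to the causal future of the data (a smooth
embedding `ι′ : X′ → M` of a connected `3`-manifold with future unit normal `ν′`, inducing the data
`(D′.h, D′.k)`, with `range ι′` a Cauchy hypersurface contained in `J⁺(ι X)`) — i.e. the supremum of
these horizon-section areas. Wald 1984, §12.2 (areas of the sections `𝓗⁺ ∩ Σ` of the event horizon
by Cauchy slices; the area theorem (12.2.5)); Chruściel–Delay–Galloway–Howard, AHP 2 (2001), §3,
(3.9). [cite: Wald1984, §12.2] -/
def horizonAreaLedger (𝒟 : VacuumCauchyDevelopment D) [𝒟.metric.HasLeviCivita] : ℝ≥0∞ :=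
  sInf {a : ENNReal | ∀ (X' : Type u) [TopologicalSpace X'] [ChartedSpace Literature.Geometry.Lorentzian.E3 X'] [IsManifold (𝓡 3) ((⊤ : ℕ∞) : WithTop ℕ∞) X'] [ConnectedSpace X'] [T2Space X'] (D' : Literature.Geometry.Lorentzian.InitialDataSet (𝓡 3) X') (ι' : X' → 𝒟.carrier) (ν' : Literature.Geometry.Lorentzian.NormalField (𝓡 4) ι'), Manifold.IsSmoothEmbedding (𝓡 3) (𝓡 4) ((⊤ : ℕ∞) : WithTop ℕ∞) ι' → 𝒟.metric.IsFutureUnitNormal (𝓡 3) 𝒟.timeOrientation ι' ν' → (∀ y : X', Literature.Geometry.Lorentzian.pullbackBilin (I := 𝓡 4) (I' := 𝓡 3) ι' 𝒟.metric.val y = D'.h.inner y) → (∀ [𝒟.metric.toPseudoRiemannianMetric.HasLeviCivita] (y : X'), 𝒟.metric.toPseudoRiemannianMetric.secondFundamentalForm (𝓡 3) ι' ν' y = D'.kBilin y) → 𝒟.metric.IsCauchyHypersurface 𝒟.timeOrientation (Set.range ι') → Set.range ι' ⊆ 𝒟.metric.causalFuture 𝒟.timeOrientation (Set.range 𝒟.embed)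 → (letI : MeasurableSpace X' := borel X'; haveI : BorelSpace X' := ⟨rfl⟩; haveI : LocallyCompactSpace X' := ChartedSpace.locallyCompactSpace Literature.Geometry.Lorentzian.E3 X'; Literature.Geometry.Lorentzian.area D'.h (ι' ⁻¹' Literature.Geometry.Lorentzian.DataEmbedding.futureEventHorizon 𝒟.toDataEmbedding)) ≤ a}

/-- **Reduction of the mass clause to the transport of cut Bondi masses** (PROVED): if a
homeomorphism `ψ : M₁ ≃ M₂` transports cut Bondi masses over compact sets,
`HasCutBondiMass 𝒟₁ K m ↔ HasCutBondiMass 𝒟₂ (ψ K) m` for compact `K`, then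
`massLedger 𝒟₁ = massLedger 𝒟₂` — compact sets correspond under `K ↦ ψ K`, `K₂ ↦ ψ⁻¹ K₂`. This is the
bookkeeping half of step 1 of the module docstring (Christodoulou–Klainerman 1993, Ch. 17,
Conclusion 17.0.4: the Bondi masses of the cuts; O'Neill 1983, Ch. 3, pp. 90–92: isometric
manifolds share every metric invariant). [cite: ChristodoulouKlainerman1993PMS41, Ch. 17, Conclusion 17.0.4] -/
theorem massLedger_eq_of_hasCutBondiMass_transport {𝒟₁ 𝒟₂ : VacuumCauchyDevelopment D}
    (ψ : 𝒟₁.carrier ≃ₜ 𝒟₂.carrier)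
    (h : ∀ (K : Set 𝒟₁.carrier) (m : ℝ), IsCompact K →
      (𝒟₁.toCauchyDevelopment.HasCutBondiMass K m ↔
        𝒟₂.toCauchyDevelopment.HasCutBondiMass (ψ '' K) m)) :
    𝒟₁.massLedger = 𝒟₂.massLedger := by
  apply le_antisymm
  · refine le_iInf fun K₂ ↦ le_iInf fun hK₂ ↦ le_iInf fun m ↦ le_iInf fun hm ↦ ?_
    have hK₁ : IsCompact (ψ.symm '' K₂) := hK₂.image ψ.symm.continuous
    have himg : ψ '' (ψ.symm '' K₂) = K₂ := ψ.image_symm_image K₂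
    have hm₁ : 𝒟₁.toCauchyDevelopment.HasCutBondiMass (ψ.symm '' K₂) m := by
      rw [h _ m hK₁, himg]
      exact hm
    exact (iInf_le _ (ψ.symm '' K₂)).trans <| (iInf_le _ hK₁).trans <|
      (iInf_le _ m).trans (iInf_le _ hm₁)
  · refine le_iInf fun K₁ ↦ le_iInf fun hK₁ ↦ le_iInf fun m ↦ le_iInf fun hm ↦ ?_
    have hK₂ : IsCompact (ψ '' K₁) := hK₁.image ψ.continuous
    have hm₂ : 𝒟₂.toCauchyDevelopment.HasCutBondiMass (ψ '' K₁) m := (h K₁ m hK₁).1 hm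
    exact (iInf_le _ (ψ '' K₁)).trans <| (iInf_le _ hK₂).trans <|
      (iInf_le _ m).trans (iInf_le _ hm₂)

/-- `massLedger 𝒟 ≤ ofReal m` whenever some compact `K` has `HasCutBondiMass 𝒟 K m` (unfolding of the
infimum; Christodoulou–Klainerman 1993, Ch. 17, Conclusion 17.0.4: the final Bondi mass is below the
Bondi mass `M(u)` of every cut). [cite: ChristodoulouKlainerman1993PMS41, Ch. 17, Conclusion 17.0.4] -/
theorem massLedger_le_ofReal {𝒟 : VacuumCauchyDevelopment D} {K : Set 𝒟.carrier} {m : ℝ}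
    (hK : IsCompact K) (hm : 𝒟.toCauchyDevelopment.HasCutBondiMass K m) :
    𝒟.massLedger ≤ ENNReal.ofReal m :=
  (iInf_le _ K).trans <| (iInf_le _ hK).trans <| (iInf_le _ m).trans (iInf_le _ hm)

end VacuumCauchyDevelopment

/-! ### The named fact -/

/-- **Brick I · `LedgerIsoInvariant` (decomp-fsc lens-5 g8, D22; VERBATIM the kernel text, sha16
`d114b4260e6e9cda`, up to the α-renaming of the three unused `let`-binders `D ↦ _D`, `D ↦ _D`,
`hLC ↦ _hLC` forced by the unused-variables linter — the term is unchanged up to α-equivalence, so the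
kernel's copy is discharged by `id`) — the two ledger entries are isometry invariants of a
development.** For every
connected `3`-manifold `X`, initial data set `d` on `X` and vacuum Cauchy developments `𝒟₁`, `𝒟₂` of
`d`: if `𝒟₁` and `𝒟₂` are isometric as Cauchy developments (a time-orientation-preserving isometric
diffeomorphism `ψ : M₁ ≃ M₂` with `ψ ∘ ι₁ = ι₂`, `CauchyDevelopment.IsIsometricTo`), then
`MassF d 𝒟₁ = MassF d 𝒟₂` and `AreaF d 𝒟₁ = AreaF d 𝒟₂`, where `MassF` (the infimum of the cut Bondi
masses) and `AreaF` (the supremum of the horizon-section areas over embedded future Cauchy slices) are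
the cell's `let`s — along `ψ`, cut Bondi masses transport (`HasCutBondiMass K m ↔
HasCutBondiMass (ψ '' K) m`, compact `K ↦ ψ '' K`), and so do the admissible horizon slices
`(X′, D′, ι′, ν′) ↦ (X′, D′, ψ ∘ ι′, ψ_* ν′)` together with `ι′ ⁻¹' 𝓗⁺(𝒟₁) = (ψ ∘ ι′) ⁻¹' 𝓗⁺(𝒟₂)`
(naturality of the future event horizon, of `pullbackBilin`, of the future unit normal and the second
fundamental form, of Cauchy hypersurfaces and of `J⁺(range ι)` under isometries; module docstring,
*Why it holds*). Structural naturality (PDE-free): isometries preserve the Levi-Civita connection,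
geodesics and curvature (O'Neill 1983, Ch. 3, Prop. 3.59–3.62) and time-orientation preserving
isometries preserve the causal relations (ibid., Ch. 14, pp. 402–403); the isometries are those of
MGHD uniqueness (Ringström 2009, Thm. 16.6; Choquet-Bruhat–Geroch 1969, Thm. 3). Equivalent unfolded
form: `ledgerIsoInvariant_iff`. Named fact (porting brick, discharge pending:
`ledgerIsoInvariant_holds`). [cite: ONeillSemiRiemannian1983, Ch. 3, Prop. 3.59–3.62 and Ch. 14, pp. 402–403] [cite: Ringstrom2009, Thm. 16.6] -/
def LedgerIsoInvariant : Prop :=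
  ∀ (X : Type) [TopologicalSpace X] [ChartedSpace Literature.Geometry.Lorentzian.E3 X] [IsManifold (𝓡 3) ((⊤ : ℕ∞) : WithTop ℕ∞) X] [T2Space X] [SecondCountableTopology X] [ConnectedSpace X], let MassF : (D : Literature.Geometry.Lorentzian.InitialDataSet (𝓡 3) X) → Literature.Geometry.Lorentzian.VacuumCauchyDevelopment D → ENNReal := fun _D 𝒟 ↦ ⨅ (K : Set 𝒟.carrier) (_ : IsCompact K) (m : ℝ) (_ : 𝒟.toCauchyDevelopment.HasCutBondiMass K m), ENNReal.ofReal m; let AreaF : (D : Literature.Geometry.Lorentzian.InitialDataSet (𝓡 3) X) → (𝒟 : Literature.Geometry.Lorentzian.VacuumCauchyDevelopment D) → [𝒟.metric.HasLeviCivita] → ENNReal := fun _D 𝒟 _hLC ↦ sInf {a : ENNReal | ∀ (X' : Type) [TopologicalSpace X'] [ChartedSpace Literature.Geometry.Lorentzian.E3 X'] [IsManifold (𝓡 3) ((⊤ : ℕ∞) : WithTop ℕ∞) X'] [ConnectedSpace X'] [T2Space X'] (D' : Literature.Geometry.Lorentzian.InitialDataSet (𝓡 3) X') (ι' : X' → 𝒟.carrier)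 (ν' : Literature.Geometry.Lorentzian.NormalField (𝓡 4) ι'), Manifold.IsSmoothEmbedding (𝓡 3) (𝓡 4) ((⊤ : ℕ∞) : WithTop ℕ∞) ι' → 𝒟.metric.IsFutureUnitNormal (𝓡 3) 𝒟.timeOrientation ι' ν' → (∀ y : X', Literature.Geometry.Lorentzian.pullbackBilin (I := 𝓡 4) (I' := 𝓡 3) ι' 𝒟.metric.val y = D'.h.inner y) → (∀ [𝒟.metric.toPseudoRiemannianMetric.HasLeviCivita] (y : X'), 𝒟.metric.toPseudoRiemannianMetric.secondFundamentalForm (𝓡 3) ι' ν' y = D'.kBilin y) → 𝒟.metric.IsCauchyHypersurface 𝒟.timeOrientation (Set.range ι') → Set.range ι' ⊆ 𝒟.metric.causalFuture 𝒟.timeOrientation (Set.range 𝒟.embed) → (letI : MeasurableSpace X' := borel X'; haveI : BorelSpace X' := ⟨rfl⟩; haveI : LocallyCompactSpace X' := ChartedSpace.locallyCompactSpace Literature.Geometry.Lorentzian.E3 X'; Literature.Geometry.Lorentzian.area D'.h (ι' ⁻¹' Literature.Geometry.Lorentzian.DataEmbedding.futureEventHorizon 𝒟.toDataEmbedding)) ≤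 a}; ∀ (d : Literature.Geometry.Lorentzian.InitialDataSet (𝓡 3) X) (𝒟₁ 𝒟₂ : Literature.Geometry.Lorentzian.VacuumCauchyDevelopment d), 𝒟₁.toCauchyDevelopment.IsIsometricTo 𝒟₂.toCauchyDevelopment → ∀ [𝒟₁.metric.HasLeviCivita] [𝒟₂.metric.HasLeviCivita], MassF d 𝒟₁ = MassF d 𝒟₂ ∧ AreaF d 𝒟₁ = AreaF d 𝒟₂

/-- **Unfolding of `LedgerIsoInvariant` in the vocabulary of this file**: the cell's `let`s `MassF`,
`AreaF` are `VacuumCauchyDevelopment.massLedger`, `VacuumCauchyDevelopment.horizonAreaLedger`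
(definitionally). [cite: ONeillSemiRiemannian1983, Ch. 3, Prop. 3.59–3.62 and Ch. 14, pp. 402–403] -/
theorem ledgerIsoInvariant_iff :
    LedgerIsoInvariant ↔
      ∀ (X : Type) [TopologicalSpace X] [ChartedSpace E3 X] [IsManifold (𝓡 3) ∞ X] [T2Space X]
        [SecondCountableTopology X] [ConnectedSpace X] (d : InitialDataSet (𝓡 3) X)
        (𝒟₁ 𝒟₂ : VacuumCauchyDevelopment d),
        𝒟₁.toCauchyDevelopment.IsIsometricTo 𝒟₂.toCauchyDevelopment →
          ∀ [𝒟₁.metric.HasLeviCivita] [𝒟₂.metric.HasLeviCivita],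
            𝒟₁.massLedger = 𝒟₂.massLedger ∧ 𝒟₁.horizonAreaLedger = 𝒟₂.horizonAreaLedger :=
  Iff.rfl

/-- The mass clause of `LedgerIsoInvariant`: isometric vacuum Cauchy developments have the same
cut-Bondi-mass ledger entry. [cite: ONeillSemiRiemannian1983, Ch. 3, Prop. 3.59–3.62] -/
theorem LedgerIsoInvariant.massLedger_eq (h : LedgerIsoInvariant) {X : Type} [TopologicalSpace X]
    [ChartedSpace E3 X] [IsManifold (𝓡 3) ∞ X] [T2Space X] [SecondCountableTopology X]
    [ConnectedSpace X] {d : InitialDataSet (𝓡 3) X} {𝒟₁ 𝒟₂ : VacuumCauchyDevelopment d}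
    (hiso : 𝒟₁.toCauchyDevelopment.IsIsometricTo 𝒟₂.toCauchyDevelopment) :
    𝒟₁.massLedger = 𝒟₂.massLedger :=
  haveI := 𝒟₁.metric.toPseudoRiemannianMetric.hasLeviCivita
  haveI := 𝒟₂.metric.toPseudoRiemannianMetric.hasLeviCivita
  (ledgerIsoInvariant_iff.1 h X d 𝒟₁ 𝒟₂ hiso).1

/-- The area clause of `LedgerIsoInvariant`: isometric vacuum Cauchy developments have the same
horizon-section area ledger entry. [cite: ONeillSemiRiemannian1983, Ch. 14, pp. 402–403] -/
theorem LedgerIsoInvariant.horizonAreaLedger_eq (h : LedgerIsoInvariant) {X : Type}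
    [TopologicalSpace X] [ChartedSpace E3 X] [IsManifold (𝓡 3) ∞ X] [T2Space X]
    [SecondCountableTopology X] [ConnectedSpace X] {d : InitialDataSet (𝓡 3) X}
    {𝒟₁ 𝒟₂ : VacuumCauchyDevelopment d}
    (hiso : 𝒟₁.toCauchyDevelopment.IsIsometricTo 𝒟₂.toCauchyDevelopment)
    [𝒟₁.metric.HasLeviCivita] [𝒟₂.metric.HasLeviCivita] :
    𝒟₁.horizonAreaLedger = 𝒟₂.horizonAreaLedger :=
  (ledgerIsoInvariant_iff.1 h X d 𝒟₁ 𝒟₂ hiso).2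

/-- `LedgerIsoInvariant` is symmetric in the two developments, as is `IsIsometricTo`
(`CauchyDevelopment.IsIsometricTo.symm`); recorded as the one-line consequence that the conclusion
for `(𝒟₂, 𝒟₁)` follows from the hypothesis for `(𝒟₁, 𝒟₂)`. [cite: ONeillSemiRiemannian1983, Ch. 3, Prop. 3.59–3.62] -/
theorem LedgerIsoInvariant.symm_apply (h : LedgerIsoInvariant) {X : Type} [TopologicalSpace X]
    [ChartedSpace E3 X] [IsManifold (𝓡 3) ∞ X] [T2Space X] [SecondCountableTopology X]
    [ConnectedSpace X] {d : InitialDataSet (𝓡 3) X} {𝒟₁ 𝒟₂ : VacuumCauchyDevelopment d}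
    (hiso : 𝒟₁.toCauchyDevelopment.IsIsometricTo 𝒟₂.toCauchyDevelopment)
    [𝒟₁.metric.HasLeviCivita] [𝒟₂.metric.HasLeviCivita] :
    𝒟₂.massLedger = 𝒟₁.massLedger ∧ 𝒟₂.horizonAreaLedger = 𝒟₁.horizonAreaLedger :=
  ledgerIsoInvariant_iff.1 h X d 𝒟₂ 𝒟₁ hiso.symm

end Developments

end Literature.Geometry.Lorentzian

end
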